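import Mathlib.FieldTheory.Galois.Basic
import Mathlib.NumberTheory.NumberField.CMField
import Literature.NumberTheory.Automorphic.AutomorphicRepsGL
import HarnessLib

/-!
# Clozel's algebraicity theorem for regular algebraic cuspidal representations of `GL_n`
# (`Aut(ℂ)`-conjugates, rationality field, archimedean purity)

Automorphic named-fact file on the carriers of `AutomorphicRepsGL.lean`
(`CuspidalAutomorphicRepData n K hcpt`, `AutomorphicRepData.HasSatakeParamAt` with the
Satake–Tamagawa eigenvalues `t_{v,i} = q_v^{i(n-i)/2} e_i(α)` of the double-coset operators
`[K(𝔫) diag(ϖ,…,ϖ,1,…,1) K(𝔫)]`, `HasInfinityType`, `IsRegularAlgebraic`) and of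
`InfinityType.lean` (`InfinityType K n`, weights `(a, b)` ↔ `z ↦ z^a z̄^b`).

## Sources

* L. Clozel, *Motifs et formes automorphes: applications du principe de fonctorialité*, in
  Automorphic forms, Shimura varieties, and L-functions I (Ann Arbor 1988), Academic Press 1990
  [Clozel1990]: Déf. 1.8 (algébrique), Déf. 3.12 (régulière), **Théorème 3.13**, Lemme 4.9
  (lemme de pureté). Not held; read through the restatement of
* S. Patrikis, *Variations on a theorem of Tate*, Mem. AMS 258 (2019) no. 1238 = arXiv:1207.6724
  [Patrikis2019], §3.2 (arXiv numbering; held text `paper:arxiv-1207.6724`, chunk 24):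
  "**Theorem 3.2.1 (Théorème 3.13 of [Clozel]).** Let `F` be any number field, and suppose `π` is
  a cuspidal, C- or L-algebraic automorphic representation of `GL_n(𝔸_F)` that is moreover regular.
  Then `π_f` has a model over the fixed field `ℚ(π_f) ⊂ ℚ̄ ⊂ ℂ` of all automorphisms
  `σ ∈ Aut(ℂ)` such that `^σπ_f ≅ π_f`, with `ℚ(π_f)` in fact a number field for `π` C-algebraic.
  For each `σ ∈ Aut(ℂ)` there is a cuspidal representation `^σπ` with finite part
  `^σπ_f = π_f ⊗_{ℂ,σ} ℂ` and with infinity-type `^σM`", where `M = {μ_ι}_ι` is the infinity type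
  and `^σM = {μ_{σ⁻¹ι}}_ι` (ibid., first paragraph of §3.2); "**Corollary 3.2.3.** The field
  `ℚ(π_f)` is CM" (ibid.; "CM" in the sense of Patrikis's conventions, chunk 11: CM fields "and
  their real subfields, are the number fields on which complex conjugation is well-defined" —
  i.e. CM or totally real; proof: `π^∨ ≅ ^cπ` for unitary `π`); and §4 (chunk 26):
  "Lemme 4.9 of [Clozel], which shows that `Π_∞` itself is quasi-tempered", used there in the
  form `Re(μ_{v,i} + ν_{v,i}) = w` independent of `i` and `v` (the motivic weight `w ∈ ℤ` with
  `Π |·|^{-w/2}` unitary) — Clozel's **archimedean purity**: for a regular algebraic cuspidal `π`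
  there is `w ∈ ℤ` with `a_{ι,i} + b_{ι,i} = w` for the GENUINE type, i.e. (since `{b at ι} =
  {a at c∘ι}`) the `a`-multiset at `c ∘ ι` is `{w − a : a ∈ a-multiset at ι}` — rendered on the
  multisets, which is all `HasInfinityType` reads.

## The RepData rendering (what is weaker than print, and why it is faithful)

The tree has no `GL_n(𝔸_f)`-module `π_f` and no `Aut(ℂ)`-action on it. Both are replaced by
the unramified Hecke eigensystem, on which `Aut(ℂ)` acts through its values:
* `heckeEigenvalueOf v α i = q_v^{i(n-i)/2} e_i(α)` is VERBATIM the eigenvalue used in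
  `HasSatakeParamAt` (the double-coset operators are integral, so `^σπ_f ≅ π_f ⊗_{ℂ,σ} ℂ` has
  eigenvalues `σ(t_{v,i})` — this is how `σ` acts on unramified local components; no choice of
  `√q_v` is involved since `i(n-i)`-th powers of `√q_v` are paired with `e_i` exactly as printed
  in the Satake transform);
* `IsAutConjugate σ π π'`: at all but finitely many finite places the eigenvalues of `π'` are the
  `σ`-conjugates of those of `π` — implied by, hence at most as strong as, `π'_f ≅ π_f ⊗_{ℂ,σ} ℂ`;
* `heckeStabilizer π ≤ Aut(ℂ)` (= `ℂ ≃ₐ[ℚ] ℂ`): the `σ` fixing the eigenvalues of `π` at almost all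
  places, and `ratField π = Fix(heckeStabilizer π)` (Mathlib `IntermediateField.fixedField`). By
  the conjugation statement (ii) below and strong multiplicity one (Jacquet–Shalika 1981) this
  stabiliser is Clozel's `{σ : ^σπ_f ≅ π_f}`, so `ratField π` is his `ℚ(π_f)`;
* the conjugated infinity type `InfinityType.autConj T σ = (ι ↦ T(σ⁻¹ ∘ ι))` is Patrikis's `^σM`
  (for C-algebraic `T` the weights are rational, so `σ` moves only the embedding index).

## What is vendored

`Clozel1990_regularAlgebraic` — for every number field `K`, `n`, every CUSPIDAL `π` on
`GL_n(𝔸_K)` that is REGULAR ALGEBRAIC (`IsRegularAlgebraic`: Clozel's algébrique = C-algebraic,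
and régulière): (i) `ratField π` is finite over `ℚ` (Thm. 3.13: "`ℚ(π_f)` is a number field");
(ii) for every `σ ∈ Aut(ℂ)` there is a cuspidal `π'` with `IsAutConjugate σ π π'` having, for
every regular algebraic infinity type `T` of `π`, an infinity type with the `a`-multisets of
`T.autConj σ` (Thm. 3.13; multisets, not pairings: `HasInfinityType` only reads `{a_i}`, and a
re-paired `T` need not have `T.autConj σ` well formed); (iii) archimedean purity on multisets
(Lemme 4.9, stated under the hypotheses of Thm. 3.13); (iv) `ratField π` is totally real
or CM (Patrikis Cor. 3.2.3). Proved here: the stabiliser is a subgroup, unfolding lemmas, and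
`autConj` bookkeeping (`autConj_one`, `autConj_mul`).

Deliberately NOT here: the existence of a MODEL of `π_f` over `ℚ(π_f)` (no `π_f` carrier); the
L-algebraic variant (Patrikis: "follows easily by twisting"); Clozel's conjecture for isobaric
non-regular `π`; the cohomological proof (§3.5 with Franke 1998), cited not re-proved.
-/

noncomputable section

open scoped Classical
open NumberField IsDedekindDomain

namespace Literature.NumberTheory.Automorphic

/-! ### `Aut(ℂ)`-conjugation of infinity types and of unramified Hecke eigensystems -/

namespace InfinityType

variable {K : Type*} [Field K] {n : ℕ}

/-- The **`Aut(ℂ)`-conjugate infinity type** `^σM = (μ_{σ⁻¹ ι})_ι` (Patrikis, §3.2, first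
paragraph; Clozel Thm. 3.13): re-index the embeddings `ι : K →+* ℂ` by `σ⁻¹ ∘ ι`. [cite: Patrikis2019, §3.2 (arXiv:1207.6724) before Thm. 3.2.1] -/
def autConj (T : InfinityType K n) (σ : ℂ ≃ₐ[ℚ] ℂ) : InfinityType K n :=
  fun ι ↦ T ((σ.symm : ℂ ≃ₐ[ℚ] ℂ).toAlgHom.toRingHom.comp ι)

/-- Unfolding `autConj`. [folklore] -/
@[simp] theorem autConj_apply (T : InfinityType K n) (σ : ℂ ≃ₐ[ℚ] ℂ) (ι : K →+* ℂ) :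
    T.autConj σ ι = T ((σ.symm : ℂ ≃ₐ[ℚ] ℂ).toAlgHom.toRingHom.comp ι) :=
  rfl

/-- Conjugating by the identity does nothing. [folklore] -/
@[simp] theorem autConj_one (T : InfinityType K n) : T.autConj 1 = T := by
  funext ι
  rfl

/-- `^{στ}M = ^σ(^τM)` (a left action: `(στ)⁻¹ι = τ⁻¹(σ⁻¹ι)`). [folklore] -/
theorem autConj_mul (T : InfinityType K n) (σ τ : ℂ ≃ₐ[ℚ] ℂ) :
    T.autConj (σ * τ) = (T.autConj τ).autConj σ := by
  funext ι
  rfl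

end InfinityType

section Hecke

variable {n : ℕ} {K : Type} [Field K] [NumberField K]

/-- The **`i`-th unramified Hecke eigenvalue attached to a Satake parameter** `α` at `v`:
`t_{v,i} = q_v^{i(n-i)/2} e_i(α)`, VERBATIM the eigenvalue of `[K(𝔫) diag(ϖ×i, 1×(n-i)) K(𝔫)]`
in `AutomorphicRepData.HasSatakeParamAt` (Satake–Tamagawa; `q_v^{i(n-i)/2}` as the
`i(n-i)`-th power of `√q_v`). [cite: Tamagawa1963] -/
def heckeEigenvalueOf (n : ℕ) (v : HeightOneSpectrum (𝓞 K)) (α : Multiset ℂ) (i : ℕ) : ℂ :=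
  ((((Real.sqrt (v.residueCard : ℝ)) : ℝ) : ℂ) ^ (i * (n - i))) * α.esymm i

variable {hcpt : isCompact_glFiniteIntegralLevel n K}

/-- `π'` is the **`σ`-conjugate of `π` at almost all places**: for all but finitely many finite
`v`, both are unramified and the unramified Hecke eigenvalues of `π'` are the `σ`-conjugates of
those of `π`, `t_{v,i}(π') = σ(t_{v,i}(π))` for `0 ≤ i ≤ n` — the a.e. shadow of Clozel's
`^σπ_f = π_f ⊗_{ℂ,σ} ℂ` (the double-coset operators being integral). [cite: Clozel1990, Thm. 3.13 (finite part)] -/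
def IsAutConjugate (σ : ℂ ≃ₐ[ℚ] ℂ) (π π' : AutomorphicRepData (AutomorphyDatum.gl n K hcpt)) : Prop :=
  ∀ᶠ v : HeightOneSpectrum (𝓞 K) in Filter.cofinite, ∃ α α' : Multiset ℂ,
    π.HasSatakeParamAt v α ∧ π'.HasSatakeParamAt v α' ∧
      ∀ i ≤ n, heckeEigenvalueOf n v α' i = σ (heckeEigenvalueOf n v α i)

/-- The **stabiliser of the unramified Hecke eigensystem** of `π` in `Aut(ℂ) = (ℂ ≃ₐ[ℚ] ℂ)`: the
automorphisms fixing, at all but finitely many finite places, every unramified Hecke eigenvalue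
of `π` (for cuspidal regular algebraic `π` this is Clozel's `{σ : ^σπ_f ≅ π_f}`, by Thm. 3.13(ii)
and strong multiplicity one). [cite: Clozel1990, Thm. 3.13 (ℚ(π_f))] -/
def heckeStabilizer (π : AutomorphicRepData (AutomorphyDatum.gl n K hcpt)) :
    Subgroup (ℂ ≃ₐ[ℚ] ℂ) where
  carrier := {σ | ∀ᶠ v : HeightOneSpectrum (𝓞 K) in Filter.cofinite, ∀ α : Multiset ℂ,
    π.HasSatakeParamAt v α → ∀ i ≤ n, σ (heckeEigenvalueOf n v α i) = heckeEigenvalueOf n v α i}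
  one_mem' := by
    change ∀ᶠ v : HeightOneSpectrum (𝓞 K) in Filter.cofinite, _
    exact Filter.Eventually.of_forall fun _ _ _ _ _ => rfl
  mul_mem' {σ τ} hσ hτ := by
    change ∀ᶠ v : HeightOneSpectrum (𝓞 K) in Filter.cofinite, _ at hσ hτ ⊢
    filter_upwards [hσ, hτ] with v hσv hτv α hα i hi
    rw [AlgEquiv.mul_apply, hτv α hα i hi, hσv α hα i hi]
  inv_mem' {σ} hσ := by
    change ∀ᶠ v : HeightOneSpectrum (𝓞 K) in Filter.cofinite, _ at hσ ⊢
    filter_upwards [hσ] with v hσv α hα i hi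
    conv_lhs => rw [← hσv α hα i hi]
    exact σ.symm_apply_apply _

/-- Membership in the Hecke stabiliser. [folklore] -/
theorem mem_heckeStabilizer_iff (π : AutomorphicRepData (AutomorphyDatum.gl n K hcpt))
    (σ : ℂ ≃ₐ[ℚ] ℂ) :
    σ ∈ heckeStabilizer π ↔ ∀ᶠ v : HeightOneSpectrum (𝓞 K) in Filter.cofinite, ∀ α : Multiset ℂ,
      π.HasSatakeParamAt v α → ∀ i ≤ n, σ (heckeEigenvalueOf n v α i) = heckeEigenvalueOf n v α i :=
  Iff.rfl

/-- The **rationality field** `ℚ(π_f)`: the fixed field in `ℂ` of the Hecke stabiliser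
(Clozel Thm. 3.13: "the fixed field `ℚ(π_f) ⊂ ℚ̄ ⊂ ℂ` of all automorphisms `σ ∈ Aut(ℂ)` such that
`^σπ_f ≅ π_f`"; Mathlib `IntermediateField.fixedField`). [cite: Clozel1990, Thm. 3.13 (ℚ(π_f))] -/
def ratField (π : AutomorphicRepData (AutomorphyDatum.gl n K hcpt)) : IntermediateField ℚ ℂ :=
  IntermediateField.fixedField (heckeStabilizer π)

/-- Membership in `ℚ(π_f)`: fixed by every element of the Hecke stabiliser. [folklore] -/
theorem mem_ratField_iff (π : AutomorphicRepData (AutomorphyDatum.gl n K hcpt)) (z : ℂ) :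
    z ∈ ratField π ↔ ∀ σ ∈ heckeStabilizer π, σ z = z :=
  IntermediateField.mem_fixedField_iff (heckeStabilizer π) z

end Hecke

/-! ### The named fact -/

/-- **Clozel's algebraicity theorem for regular algebraic cuspidal representations, with
archimedean purity and the CM property of the rationality field** (Clozel 1990, Thm. 3.13 and
Lemme 4.9; Patrikis 2019, Thm. 3.2.1 and Cor. 3.2.3). For every number field `K`, every `n`,
and every cuspidal automorphic representation `π` of `GL_n(𝔸_K)` that is regular algebraic
(C-algebraic and regular):
(i) the rationality field `ℚ(π_f) = ratField π` is a number field (finite over `ℚ`);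
(ii) for every `σ ∈ Aut(ℂ)` there is a cuspidal `π'` on `GL_n(𝔸_K)` which is the `σ`-conjugate
of `π` at almost all places (`IsAutConjugate σ π π'`: Hecke eigenvalues `σ(t_{v,i})`) and whose
archimedean parameter is that of `^σT`: for every regular algebraic infinity type `T` of `π`, some
infinity type `T'` of `π'` has the same `a`-MULTISETS as `^σT = T.autConj σ` at every embedding
(only the multisets `{a_i}` are read by `HasInfinityType`, not the pairing, so this is the
faithful rendering of "`π'_∞` has type `^σM`");
(iii) (purity, Clozel Lemme 4.9: `p_{τ,i} + q_{cτ,n+1-i} = w`) on MULTISETS: for every regular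
algebraic infinity type `T` of `π` there is `w ∈ ℤ` with
`{a-multiset of T at c∘ι} = {w − a : a ∈ a-multiset of T at ι}` for every embedding `ι`
(a statement about the archimedean parameter only; the pairing inside `T` is not constrained by
`HasInfinityType`, so purity of the PAIRS would be false for re-paired types);
(iv) `ℚ(π_f)` is totally real or CM.
See the module docstring for the RepData rendering of `π_f ⊗_{ℂ,σ} ℂ` and `ℚ(π_f)`. [cite: Clozel1990, Thm. 3.13 and Lemme 4.9; Patrikis2019 Thm. 3.2.1, Cor. 3.2.3 (arXiv numbering)] -/
def Clozel1990_regularAlgebraic : Prop :=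
  ∀ (n : ℕ) (K : Type) [Field K] [NumberField K] (hcpt : isCompact_glFiniteIntegralLevel n K)
    (π : CuspidalAutomorphicRepData n K hcpt), π.1.IsRegularAlgebraic →
    FiniteDimensional ℚ (ratField π.1) ∧
    (∀ σ : ℂ ≃ₐ[ℚ] ℂ, ∃ π' : CuspidalAutomorphicRepData n K hcpt,
      IsAutConjugate σ π.1 π'.1 ∧
      ∀ T : InfinityType K n, π.1.HasInfinityType T → T.IsRegularAlgebraic →
        ∃ T' : InfinityType K n, π'.1.HasInfinityType T' ∧
          ∀ ι : K →+* ℂ, (T' ι).map ArchWeight.a = (T.autConj σ ι).map ArchWeight.a) ∧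
    (∀ T : InfinityType K n, π.1.HasInfinityType T → T.IsRegularAlgebraic →
      ∃ w : ℤ, ∀ ι : K →+* ℂ, (T ((starRingEnd ℂ).comp ι)).map ArchWeight.a =
        ((T ι).map ArchWeight.a).map fun a => (w : ℂ) - a) ∧
    (IsTotallyReal (ratField π.1) ∨ IsCMField (ratField π.1))

/-! ### Unpacking -/

section Consequences

variable {n : ℕ} {K : Type} [Field K] [NumberField K] {hcpt : isCompact_glFiniteIntegralLevel n K}

/-- Under the fact: `ℚ(π_f)` is a number field for cuspidal regular algebraic `π`
(Clozel Thm. 3.13). [cite: Clozel1990, Thm. 3.13] -/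
theorem Clozel1990_regularAlgebraic.finiteDimensional_ratField (h : Clozel1990_regularAlgebraic)
    (π : CuspidalAutomorphicRepData n K hcpt) (hπ : π.1.IsRegularAlgebraic) :
    FiniteDimensional ℚ (ratField π.1) :=
  (h n K hcpt π hπ).1

/-- Under the fact: existence of the `Aut(ℂ)`-conjugates (Clozel Thm. 3.13). [cite: Clozel1990, Thm. 3.13] -/
theorem Clozel1990_regularAlgebraic.exists_autConjugate (h : Clozel1990_regularAlgebraic)
    (π : CuspidalAutomorphicRepData n K hcpt) (hπ : π.1.IsRegularAlgebraic) (σ : ℂ ≃ₐ[ℚ] ℂ) :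
    ∃ π' : CuspidalAutomorphicRepData n K hcpt, IsAutConjugate σ π.1 π'.1 ∧
      ∀ T : InfinityType K n, π.1.HasInfinityType T → T.IsRegularAlgebraic →
        ∃ T' : InfinityType K n, π'.1.HasInfinityType T' ∧
          ∀ ι : K →+* ℂ, (T' ι).map ArchWeight.a = (T.autConj σ ι).map ArchWeight.a :=
  (h n K hcpt π hπ).2.1 σ

/-- Under the fact: archimedean purity of a regular algebraic cuspidal `π` (Clozel Lemme 4.9), on
multisets: the `a`-multiset of any regular algebraic infinity type of `π` at `c ∘ ι` is
`w −` (its `a`-multiset at `ι`) for one `w ∈ ℤ`. [cite: Clozel1990, Lemme 4.9] -/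
theorem Clozel1990_regularAlgebraic.purity (h : Clozel1990_regularAlgebraic)
    (π : CuspidalAutomorphicRepData n K hcpt) {T : InfinityType K n} (hT : π.1.HasInfinityType T)
    (hreg : T.IsRegularAlgebraic) :
    ∃ w : ℤ, ∀ ι : K →+* ℂ, (T ((starRingEnd ℂ).comp ι)).map ArchWeight.a =
      ((T ι).map ArchWeight.a).map fun a => (w : ℂ) - a :=
  (h n K hcpt π ⟨T, hT, hreg⟩).2.2.1 T hT hreg

/-- Under the fact: `ℚ(π_f)` is totally real or CM (Patrikis Cor. 3.2.3). [cite: Patrikis2019, Cor. 3.2.3 (arXiv numbering)] -/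
theorem Clozel1990_regularAlgebraic.isTotallyReal_or_isCMField (h : Clozel1990_regularAlgebraic)
    (π : CuspidalAutomorphicRepData n K hcpt) (hπ : π.1.IsRegularAlgebraic) :
    IsTotallyReal (ratField π.1) ∨ IsCMField (ratField π.1) :=
  (h n K hcpt π hπ).2.2.2

end Consequences

/-! ### The Hecke (coefficient) field of a regular algebraic cuspidal `π` (Clozel Thm. 3.13, as used by Böckle–Hui §3.1) -/

section HeckeField

/-- **The unramified Hecke eigenvalues of a regular algebraic cuspidal `π` lie in one number
field** (Clozel 1990, Thm. 3.13; the form in which Böckle–Hui 2025, §3.1 use it). For every number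
field `K`, every `n` and every cuspidal `π` on `GL_n(𝔸_K)` that is regular algebraic
(`IsRegularAlgebraic`), there is a number field `E ⊂ ℂ` such that for all but finitely many finite
places `v`, for every Satake parameter `α` of `π` at `v` and every `i ≤ n`, the integral Hecke
eigenvalue `t_{v,i} = q_v^{i(n-i)/2} e_i(α)` (`heckeEigenvalueOf n v α i`, VERBATIM the eigenvalue
read by `HasSatakeParamAt`) lies in `E`.

Printed statements. Böckle–Hui (arXiv:2404.08954), §3.1, for `π` regular algebraic cuspidal on
`GL_n(𝔸_K)`: "By Clozel [Cl90], `π` is C-arithmetic. By [BG14], `π` is C-arithmetic if and only if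
`π ⊗ |det|^{(1-n)/2}` is L-arithmetic. Thus, there exist a number field `E` and a finite subset
`S ⊂ Σ_K` containing the ramified primes of `π` such that the Satake parameters of
`π_v ⊗ |det|_v^{(1-n)/2}` are defined over `E` for all `v ∈ Σ_K ∖ S`."  Clozel, Thm. 3.13 (read
through Patrikis 2019, Thm. 3.2.1: "Let `F` be any number field, and suppose `π` is a cuspidal,
C- or L-algebraic automorphic representation of `GL_n(𝔸_F)` that is moreover regular. Then `π_f`
has a model over the fixed field `ℚ(π_f) ⊂ ℚ̄ ⊂ ℂ` … with `ℚ(π_f)` in fact a number field for `π`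
C-algebraic"): a model of `π_f` over the number field `E = ℚ(π_f)` makes the spherical Hecke
eigencharacter at every unramified `v` `E`-valued on the INTEGRAL double-coset operators
`[K diag(ϖ×i, 1×(n-i)) K]`, whose eigenvalues are `t_{v,i} = q_v^{i(n-i)/2} e_i(α)`
(Satake–Tamagawa, the dictionary of `heckeEigenvalueOf`). Rendering: "the Satake parameter of
`π_v ⊗ |det|_v^{(1-n)/2}` is defined over `E`" says `e_i(q_v^{(n-1)/2} α) = q_v^{i(n-1)/2} e_i(α) ∈ E`
for all `i`, and `q_v^{i(n-1)/2} e_i(α) = q_v^{i(i-1)/2} · t_{v,i}` with `q_v^{i(i-1)/2} ∈ ℚ ⊂ E`, so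
the two memberships are equivalent; Böckle–Hui's standing hypothesis "`K` totally real or CM"
(§3, first line) is not used for this sentence, which is Clozel's theorem for ANY number field
(Patrikis: "any number field"), and the fact is stated in that generality. `E : Subfield ℂ` with
`FiniteDimensional ℚ E`; the finite exceptional set is `∀ᶠ v in cofinite`.

Why a separate fact: it is not a FORMAL consequence of clause (i) of `Clozel1990_regularAlgebraic`
above, whose `ratField π` is cut out by automorphisms fixing the eigenvalues off `σ`-DEPENDENT
finite sets (no uniform cofinite set of places follows from (i) alone). It IS implied by clause
(ii) (existence of the regular algebraic cuspidal `Aut(ℂ)`-conjugates, `Clozel1990_exists_autConjugate`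
of `ClozelAlgebraicitySplit.lean`), hence by `Clozel1990_regularAlgebraic`: Baire category on
`Gal(ℚ̄/ℚ)` uniformizes the exceptional sets once the cofinite germs of the eigensystems of regular
algebraic cuspidal representations are known to form a countable set (Harish-Chandra finiteness) —
proved in the tree as
`Summit.Langlands.Langlands.Theorems.HeckeEigenvalueField.Baire.clozel1990_heckeEigenvalueField_of_exists_autConjugate`
and `….HeckeEigenvalueField_of_clozel1990_regularAlgebraic`
(`Summits/Langlands/Langlands/Theorems/IrreducibilityBySelfDualityHeckeEigenvalueFieldBaireFinal.lean`).
It is the hypothesis `hCar` of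
`isIrreducible_galoisRep_gl3_totallyReal_of_JS'` (`BockleHuiIrreducibleGL3WeightProofs.lean`) and
grounds, VERBATIM (same binders, `Iff.rfl`), the input item
`Summit.Langlands.Langlands.Theses.IrreducibilityBySelfDuality.HeckeEigenvalueField`
(fact for `IrreducibilityBySelfDuality.HeckeEigenvalueField`). Named fact (D-0014); users take
`(h : Clozel1990_heckeEigenvalueField)`.
[cite: Clozel1990, Thm. 3.13] [cite: Patrikis2019, Thm. 3.2.1 (arXiv:1207.6724, §3.2)]
[cite: BockleHui2025, §3.1 (first paragraph)] -/
def Clozel1990_heckeEigenvalueField : Prop :=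
  ∀ (n : ℕ) (K : Type) [Field K] [NumberField K] (hcpt : isCompact_glFiniteIntegralLevel n K)
    (π : CuspidalAutomorphicRepData n K hcpt), π.1.IsRegularAlgebraic →
    ∃ E : Subfield ℂ, FiniteDimensional ℚ E ∧
      ∀ᶠ v : HeightOneSpectrum (𝓞 K) in Filter.cofinite, ∀ α : Multiset ℂ,
        π.1.HasSatakeParamAt v α → ∀ i ≤ n, heckeEigenvalueOf n v α i ∈ E

/-- Under the fact: the Hecke field of one regular algebraic cuspidal `π`, unpacked.
[cite: Clozel1990, Thm. 3.13] -/
theorem Clozel1990_heckeEigenvalueField.exists_subfield (h : Clozel1990_heckeEigenvalueField)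
    {n : ℕ} {K : Type} [Field K] [NumberField K] {hcpt : isCompact_glFiniteIntegralLevel n K}
    (π : CuspidalAutomorphicRepData n K hcpt) (hπ : π.1.IsRegularAlgebraic) :
    ∃ E : Subfield ℂ, FiniteDimensional ℚ E ∧
      ∀ᶠ v : HeightOneSpectrum (𝓞 K) in Filter.cofinite, ∀ α : Multiset ℂ,
        π.1.HasSatakeParamAt v α → ∀ i ≤ n, heckeEigenvalueOf n v α i ∈ E :=
  h n K hcpt π hπ

end HeckeField

end Literature.NumberTheory.Automorphic
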